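import Summits.BirchSwinnertonDyer.BirchSwinnertonDyer.Theorems.EisensteinPrimesMazurMCOnX1RankZeroAnalyticMuIsogenyForm
import Summits.BirchSwinnertonDyer.BirchSwinnertonDyer.Theorems.ByReductionTypeAtTwoOrdKatoHalfIsogenyMu
import HarnessLib

/-!
# Crux `MazurMCOnX1RankZero` (stmt-BirchSwinnertonDyer-19035), line `mudescent`, stub
# `stub_analyticMuZero_offLocus` — the ÉTALE END IS UNIQUE up to prime-to-`p` isogeny, the
# ALGEBRAIC `μ` is a prime-to-`p` isogeny invariant, hence on a rank-`0` X1 class the members with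
# `μ(X(E/ℚ_∞)) = 0` are EXACTLY the off-locus members (or none) — WITHOUT Schneider's isogeny
# formula (cell `bsd-eis`, seat `bsd-eis-mu-b`, gen 2; CONSTRUCTION seat — closes NO stub)

p468995 (`…AnalyticMuIsogenyForm`, same seat) showed: stub ⟺ [(M) μ-part of Mazur's main conjecture
at the off-locus members] ∧ [(G_iso) Greenberg's Conj. 1.11 AS PRINTED on the rank-`0` X1 classes],
and that (G_iso) ⇒ (G_loc) [«`μ = 0` AT every off-locus member»] needed (M) — or, unconditionally,
Schneider's/Perrin-Riou's formula for the change of the ALGEBRAIC `μ` under a `p`-isogeny (ASPM 17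
(1989) Théorème p. 349; not in the tree). This file removes that dependence by a structural argument:

* §1 `mu_eq_of_isogeny_not_dvd_degree` — **`μ(X(E/K_∞))` is invariant under isogenies of degree
  prime to `p`** (any number field, any `ℤ_p`-extension, any dual data): the `Λ`-linear duals
  `F = Sel(φ)^∨`, `G = Sel(φ̂)^∨` (`X2.IsogenyLambdaInvariant.dualMap`, `Λ`-linear by
  `KatoHalfIsogeny.dualMap_smul`) satisfy `F ∘ G = n = G ∘ F` with `n = deg φ` a UNIT of `ℤ_p`, so
  `F` is a `Λ`-linear isomorphism and `μ` agrees (`muInvariant_eq_of_linearEquiv`). (Greenberg, LNM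
  1716 p. 58: «the kernel and cokernel of `Φ` have finite exponent, dividing the exponent of
  `ker(φ)`».)
* §2 `exists_isogeny_not_dvd_degree_of_forall_lineUnramifiedAt` — **uniqueness of the étale end**: at
  an odd prime of good ordinary or multiplicative reduction, two `ℚ`-isogenous globally minimal
  curves `W₁`, `W₀` BOTH having every rational `p`-line unramified are isogenous by an isogeny of
  degree PRIME TO `p`. By strong induction on `deg ψ` exactly as in mu-a's ladder
  (`exists_unit_pow_of_isogeny_to_etaleEnd_aux`, p463663): either `p ∤ deg ψ`, or `W₁[p] ⊆ ker ψ`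
  (`ψ = λ ∘ [p]`, recurse), or `ker ψ ∩ W₁[p]` is a rational line of `W₁` whose image is an
  (unramified) line of `W₀` — then it is RAMIFIED (`not_lineUnramifiedAt_ker_of_lineUnramifiedAt_range`),
  contradicting the hypothesis on `W₁`. No parity and no `μ` enters.
* §3 Consequences on the rank-`0` X1 leaf (granted Greenberg Prop. 5.7 `h57`, Wuthrich Thm. 16
  `hW16`, modularity `hmod`, as in p460164/p468995): `mu_eq_of_offLocus_of_offLocus` (two off-locus
  members have the same `μ`); **`mu_eq_zero_iff_not_hasRamifiedOddLineAt_of_exists_member`** (in a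
  class holding ONE member with `μ(X) = 0`, the members with `μ(X) = 0` are EXACTLY the off-locus
  members — the algebraic twin of p467959); **`greenbergMu_located_iff_isogenyForm`** ((G_loc) ⟺
  (G_iso) on the leaf, now WITHOUT (M)); and the final form of the decomposition,
  **`stub_iff_muPart_offLocus_and_greenbergMu`**: stub ⟺ (M)_off ∧ (G), with (G) in EITHER form.
  Greenberg's remark «the above conjecture effectively predicts the value of `μ_E`» (LNM 1716
  p. 58), case `μ = 0`, is thereby a kernel theorem on this locus: IF some member has `μ = 0`, it is
  the étale end (and every étale end).

HONEST FRAMING: theorems only (no `def`, no new named fact, no `sorry`); closes nothing; (G) = Conj.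
1.11 on the leaf stays OPEN, (M) stays the crux / KY24 (PRE). No label or count of the cell moves.
References: [GreenbergLNM1716] §1 p. 58 (isogeny paragraph, Conj. 1.11), Prop. 5.7 (p. 113);
[SilvermanAEC2009] III.4.11, III.6.1–6.2; [Wuthrich2014] Thm. 16; [BCDTJAMS2001] Thm. A;
[PerrinRiou1989Isogenie] Théorème (p. 349) (NOT used — replaced by §2); HOME
`run/shared/lean/pub/bsd-eis/mu-b-MEMO-2.md`.
-/

set_option autoImplicit false

-- `Summit.BirchSwinnertonDyer.BirchSwinnertonDyer.…`: the summit and its single sub-problem share a name (D-0017 layout).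
set_option linter.dupNamespace false

noncomputable section

open scoped Classical NumberField

universe u

open WeierstrassCurve Field IsDedekindDomain NumberField
  Literature.NumberTheory.EllipticCurves Literature.NumberTheory.EllipticCurves.Rank1Residual
  Literature.NumberTheory.EllipticCurves.ModularForms Literature.NumberTheory.GaloisRepresentations
  Literature.NumberTheory.EllipticCurves.Greenberg1999
  Literature.Barriers.BirchSwinnertonDyer
  Summit.BirchSwinnertonDyer.Rank1Residual Summit.BirchSwinnertonDyer.Rank1Residual.GVPeriod
  Summit.BirchSwinnertonDyer.Rank1Residual.X2.IsogenySelmerInfty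
  Summit.BirchSwinnertonDyer.Rank1Residual.X2.IsogenyLambdaInvariant
  Summit.BirchSwinnertonDyer.BirchSwinnertonDyer.Theorems
  Summit.BirchSwinnertonDyer.BirchSwinnertonDyer.Theorems.KatoHalfIsogeny
  Summit.BirchSwinnertonDyer.BirchSwinnertonDyer.Theorems.EisensteinPrimesMazurMCOnCellBTypeAPeriodLadder
  Summit.BirchSwinnertonDyer.BirchSwinnertonDyer.Theorems.EisensteinPrimesMazurMCOnX1RankZeroAnalyticMuMinimal
  Summit.BirchSwinnertonDyer.BirchSwinnertonDyer.Theorems.EisensteinPrimesMazurMCOnX1RankZeroAnalyticMuOffLocus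
  Summit.BirchSwinnertonDyer.BirchSwinnertonDyer.Theorems.EisensteinPrimesMazurMCOnX1RankZeroAnalyticMuIsogenyForm
  Summit.BirchSwinnertonDyer.BirchSwinnertonDyer.Theorems.EisensteinPrimesMazurMCOnX1RankZeroAnalyticMuDecomposition

namespace Summit.BirchSwinnertonDyer.BirchSwinnertonDyer.Theorems.EisensteinPrimesMazurMCOnX1RankZeroMuEtaleEnd

/-! ## §1. `μ(X(E/K_∞))` is invariant under isogenies of degree prime to `p` -/

section PrimeToP

variable {K : Type u} [Field K] [NumberField K] {W W' : WeierstrassCurve K} [W.IsElliptic]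
  [W'.IsElliptic] {p : ℕ} [Fact p.Prime] {κ : ZpExtension K p} {γ : absoluteGaloisGroup K}

/-- **The algebraic `μ`-invariant is invariant under isogenies of degree prime to `p`.** For a
`K`-isogeny `φ : E → E′` with `p ∤ deg φ`, any `ℤ_p`-extension `κ`, any `γ`, and dual data `D`, `D′` of `Sel_{p^∞}(E/K_∞)`, `Sel_{p^∞}(E′/K_∞)`: `D′.mu = D.mu`. The `Λ`-linear
duals `F = Sel(φ)^∨ : X′ → X`, `G = Sel(φ̂)^∨ : X → X′` satisfy `F ∘ G = n`, `G ∘ F = n`, `n = deg φ`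
a unit of `ℤ_p ⊂ Λ`; so `F` is a `Λ`-linear isomorphism and `μ(X′) = μ(X)`. No torsion hypothesis
(both `μ` are computed from isomorphic modules). Greenberg: «the kernel and cokernel of `Φ` have
finite exponent, dividing the exponent of `ker(φ)`». [cite: GreenbergLNM1716, §1 p. 58 (the isogeny paragraph)]
[cite: SilvermanAEC2009, III.6.1–6.2] -/
theorem mu_eq_of_isogeny_not_dvd_degree (φ : Isogeny W W') (hpn : ¬ p ∣ φ.degree)
    (D : W.SelmerDualData κ γ) (D' : W'.SelmerDualData κ γ) : D'.mu = D.mu := by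
  have hpP : p.Prime := Fact.out
  obtain ⟨ψ, hψ⟩ := φ.exists_dual_of_isElliptic
  set n : ℕ := φ.degree with hn
  have hφψ : ∀ Q : W'.geomPoints, φ (ψ Q) = (n : ℤ) • Q := by
    intro Q
    obtain ⟨P, rfl⟩ := φ.surjective Q
    rw [hψ, map_zsmul]
  set α := isogenySelmerInftyMap p κ φ with hα
  set β := isogenySelmerInftyMap p κ ψ with hβ
  have hβα : ∀ s, β (α s) = n • s := fun s ↦ isogenySelmerInftyMap_comp_apply p κ φ ψ hψ s
  have hαβ : ∀ s, α (β s) = n • s := fun s ↦ isogenySelmerInftyMap_comp_apply p κ ψ φ hφψ s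
  -- the `Λ`-linear duals
  let F : D'.X →ₗ[IwasawaAlgebra p] D.X :=
    { toFun := dualMap D D' α
      map_add' := (dualMap D D' α).map_add
      map_smul' := fun c x' ↦ dualMap_smul D D' α (isogenySelmerInftyMap_conjSelmerInfty κ φ) c x' }
  let G : D.X →ₗ[IwasawaAlgebra p] D'.X :=
    { toFun := dualMap D' D β
      map_add' := (dualMap D' D β).map_add
      map_smul' := fun c x ↦ dualMap_smul D' D β (isogenySelmerInftyMap_conjSelmerInfty κ ψ) c x }
  have hFG : ∀ x, F (G x) = n • x := fun x ↦ dualMap_dualMap_of_comp_eq_nsmul D D' α β hβα x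
  have hGF : ∀ x', G (F x') = n • x' := fun x' ↦ dualMap_dualMap_of_comp_eq_nsmul D' D β α hαβ x'
  -- `n` is a unit of `Λ`
  have hunitZ : IsUnit ((n : ℕ) : ℤ_[p]) := by
    rw [PadicInt.isUnit_iff, PadicInt.norm_natCast_eq_one_iff]
    exact (Nat.Prime.coprime_iff_not_dvd hpP).mpr hpn
  have hunit : IsUnit ((n : ℕ) : IwasawaAlgebra p) := by
    have := hunitZ.map (PowerSeries.C (R := ℤ_[p]))
    rwa [map_natCast] at this
  obtain ⟨u, hu⟩ := hunit
  have hFG' : ∀ x, F (G x) = (u : IwasawaAlgebra p) • x := fun x ↦ by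
    rw [hFG, hu, Nat.cast_smul_eq_nsmul]
  have hGF' : ∀ x', G (F x') = (u : IwasawaAlgebra p) • x' := fun x' ↦ by
    rw [hGF, hu, Nat.cast_smul_eq_nsmul]
  have hkey : ∀ y : D'.X, ((u⁻¹ : (IwasawaAlgebra p)ˣ) : IwasawaAlgebra p) •
      ((u : IwasawaAlgebra p) • y) = y := fun y ↦ by
    rw [smul_smul, Units.inv_mul, one_smul]
  have hinj : Function.Injective F := by
    intro x₁ x₂ h
    have h' : (u : IwasawaAlgebra p) • x₁ = (u : IwasawaAlgebra p) • x₂ := by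
      rw [← hGF', ← hGF', h]
    rw [← hkey x₁, ← hkey x₂, h']
  have hsurj : Function.Surjective F := by
    intro x
    refine ⟨G (((u⁻¹ : (IwasawaAlgebra p)ˣ) : IwasawaAlgebra p) • x), ?_⟩
    rw [map_smul, map_smul, hFG', smul_smul, Units.inv_mul, one_smul]
  let e : D'.X ≃ₗ[IwasawaAlgebra p] D.X := LinearEquiv.ofBijective F ⟨hinj, hsurj⟩
  show muInvariant p D'.X = muInvariant p D.X
  exact muInvariant_eq_of_linearEquiv e

/-- `IsIsogenous`-free corollary with the torsion bookkeeping: along an isogeny of degree prime to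
`p`, `X(E′/K_∞)` is torsion as soon as `X(E/K_∞)` is (`isTorsion_and_charIdeal_mul_span_eq_of_isogeny`)
and the `μ`-invariants agree. [cite: GreenbergLNM1716, §1 p. 58] -/
theorem isTorsion_and_mu_eq_of_isogeny_not_dvd_degree (φ : Isogeny W W') (hpn : ¬ p ∣ φ.degree)
    (hγ : κ.IsTopGenerator γ) (D : W.SelmerDualData κ γ) (D' : W'.SelmerDualData κ γ)
    (hX : D.IsTorsion) : D'.IsTorsion ∧ D'.mu = D.mu :=
  ⟨(D.isTorsion_and_charIdeal_mul_span_eq_of_isogeny D' φ hγ hX).1,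
    mu_eq_of_isogeny_not_dvd_degree φ hpn D D'⟩

end PrimeToP

/-! ## §2. Uniqueness of the étale end up to prime-to-`p` isogeny -/

section EtaleEnd

variable {p : ℕ} [hp : Fact p.Prime]

/-- **Two étale ends of one class are isogenous by an isogeny of degree prime to `p`** (strong
induction on the degree). `W₁`, `W₀` globally minimal over `ℚ`, `p` odd, `W₁` of good ordinary or
multiplicative reduction at `p`, EVERY rational `p`-line of `W₁` AND of `W₀` unramified at `p`,
`ψ : W₁ → W₀` of degree `n`: there is `λ : W₁ → W₀` with `p ∤ deg λ`. Cases: `p ∤ n`; `W₁[p] ⊆ ker ψ`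
(`ψ = λ ∘ [p]`, `deg λ = n/p² < n`); else `Φ₀ = ker ψ ∩ W₁[p]` is a rational line of `W₁` whose image
under `ψ|_{W₁[p]}` is a rational line of `W₀`, unramified by hypothesis, so `Φ₀` is RAMIFIED
(`not_lineUnramifiedAt_ker_of_lineUnramifiedAt_range`, with the inertia line `exists_inertiaLine₁`)
— contradicting the hypothesis on `W₁`. The skeleton is mu-a's `exists_unit_pow_of_isogeny_to_etaleEnd_aux`.
[cite: SilvermanAEC2009, Cor. III.4.11 and Thm. III.6.1] [cite: SerreInventiones1972, §1.11 Prop. 11 and Cor.] -/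
theorem exists_isogeny_not_dvd_degree_aux (hp2 : p ≠ 2) (n : ℕ) :
    ∀ (W₁ W₀ : WeierstrassCurve ℚ) (_ : W₁.IsElliptic) (_ : W₀.IsElliptic)
      (_ : W₁.IsGloballyMinimal) (_ : W₀.IsGloballyMinimal),
      ((W₁.HasGoodReductionAtPrime p ∧ ¬ (p : ℤ) ∣ W₁.frobeniusTrace p) ∨
        W₁.HasMultiplicativeReductionAtPrime p) →
      (∀ Φ : AddSubgroup (geomTorsion W₁ (p : ℤ)), IsRationalLine W₁ p Φ → LineUnramifiedAt W₁ p Φ) →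
      (∀ Φ : AddSubgroup (geomTorsion W₀ (p : ℤ)), IsRationalLine W₀ p Φ → LineUnramifiedAt W₀ p Φ) →
      ∀ ψ : Isogeny W₁ W₀, ψ.degree = n → ∃ lam : Isogeny W₁ W₀, ¬ p ∣ lam.degree := by
  induction n using Nat.strong_induction_on with
  | _ n ih =>
  intro W₁ W₀ _ _ _ _ hred hW₁ hW₀ ψ hn
  have hpP : p.Prime := hp.out
  by_cases hpn : p ∣ n
  swap
  · exact ⟨ψ, hn ▸ hpn⟩
  by_cases hall : ∀ P ∈ geomTorsion W₁ (p : ℤ), ψ P = 0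
  · -- `W₁[p] ⊆ ker ψ`: `ψ = λ ∘ [p]`
    have hpK : ((p : ℤ) : ℚ) ≠ 0 := by exact_mod_cast hpP.ne_zero
    have hp0 : (p : ℤ) ≠ 0 := by exact_mod_cast hpP.ne_zero
    obtain ⟨lam, hlam⟩ := Isogeny.exists_eq_comp_zsmul_of_geomTorsion_le_ker hpK ψ hall
    have hfac : ∀ P, ψ P = lam (Isogeny.zsmul W₁ (p : ℤ) hp0 P) := fun P ↦ by
      rw [Isogeny.zsmul_apply]; exact hlam P
    have hcount := natCard_ker_eq_mul_of_factor (Isogeny.zsmul W₁ (p : ℤ) hp0) ψ lam hfac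
    have hkp : Nat.card (Isogeny.zsmul W₁ (p : ℤ) hp0).toAddMonoidHom.ker = p ^ 2 := by
      rw [Isogeny.ker_zsmul]; exact Rank1Residual.natCard_geomTorsion W₁ p
    rw [hkp] at hcount
    have hlt : lam.degree < n := by
      rw [← hn]
      change Nat.card lam.toAddMonoidHom.ker < Nat.card ψ.toAddMonoidHom.ker
      have h1 : 1 < p ^ 2 := Nat.one_lt_pow two_ne_zero hpP.one_lt
      have h2 : 0 < Nat.card lam.toAddMonoidHom.ker := lam.degree_pos
      calc Nat.card lam.toAddMonoidHom.ker
          = Nat.card lam.toAddMonoidHom.ker * 1 := (mul_one _).symm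
        _ < Nat.card lam.toAddMonoidHom.ker * p ^ 2 := Nat.mul_lt_mul_of_pos_left h1 h2
        _ = Nat.card ψ.toAddMonoidHom.ker := hcount.symm
    exact ih lam.degree hlt W₁ W₀ inferInstance inferInstance inferInstance inferInstance hred hW₁
      hW₀ lam rfl
  · -- `Φ₀ = ker ψ ∩ W₁[p]` is a rational line; its image is an unramified line of `W₀`, so `Φ₀`
    -- is ramified: contradiction with `hW₁`
    exfalso
    obtain ⟨P₁, hP₁'⟩ := not_forall.mp hall
    obtain ⟨hP₁, hψP₁⟩ := Classical.not_imp.mp hP₁'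
    set Φ₀ := ψ.toAddMonoidHom.ker.comap (geomTorsion W₁ (p : ℤ)).subtype with hΦ₀def
    have hΦ₀ : IsRationalLine W₁ p Φ₀ :=
      isRationalLine_ker_inf_torsion ψ (hn ▸ hpn) ⟨P₁, hP₁, hψP₁⟩
    obtain ⟨g, hgval, hg⟩ := X2.IsogenyLineType.exists_restrict_torsion (p := p) ψ
    have hKg : g.ker = Φ₀ := by
      ext P
      rw [AddMonoidHom.mem_ker, hΦ₀def, AddSubgroup.mem_comap, AddMonoidHom.mem_ker,
        Isogeny.coe_toAddMonoidHom, AddSubgroup.coe_subtype, ← hgval]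
      exact ⟨fun h ↦ by rw [h]; rfl, fun h ↦ Subtype.ext h⟩
    have hKcard : Nat.card g.ker = p := by rw [hKg]; exact hΦ₀.1
    have hrange : IsRationalLine W₀ p g.range :=
      isRationalLine_range g hg (Rank1Residual.natCard_geomTorsion W₁ p) hKcard
    have hram : ¬ LineUnramifiedAt W₁ p Φ₀ := hKg ▸
      not_lineUnramifiedAt_ker_of_lineUnramifiedAt_range g hg (exists_inertiaLine₁ W₁ p hp2 hred)
        hKcard (hW₀ _ hrange)
    exact hram (hW₁ Φ₀ hΦ₀)

/-- **Uniqueness of the étale end, `IsIsogenous` form**: two `ℚ`-isogenous globally minimal curves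
all of whose rational `p`-lines are unramified (at an odd good-ordinary-or-multiplicative `p`) are
related by an isogeny of degree prime to `p`. [cite: SilvermanAEC2009, Cor. III.4.11 and Thm. III.6.1]
[cite: GreenbergLNM1716, Conj. 1.11 (p. 58)] -/
theorem exists_isogeny_not_dvd_degree_of_forall_lineUnramifiedAt {W₁ W₀ : WeierstrassCurve ℚ}
    [W₁.IsElliptic] [W₀.IsElliptic] [W₁.IsGloballyMinimal] [W₀.IsGloballyMinimal] (hp2 : p ≠ 2)
    (hred : (W₁.HasGoodReductionAtPrime p ∧ ¬ (p : ℤ) ∣ W₁.frobeniusTrace p) ∨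
      W₁.HasMultiplicativeReductionAtPrime p)
    (hW₁ : ∀ Φ : AddSubgroup (geomTorsion W₁ (p : ℤ)), IsRationalLine W₁ p Φ → LineUnramifiedAt W₁ p Φ)
    (hW₀ : ∀ Φ : AddSubgroup (geomTorsion W₀ (p : ℤ)), IsRationalLine W₀ p Φ → LineUnramifiedAt W₀ p Φ)
    (hiso : IsIsogenous W₁ W₀) : ∃ lam : Isogeny W₁ W₀, ¬ p ∣ lam.degree := by
  obtain ⟨ψ⟩ := hiso
  exact exists_isogeny_not_dvd_degree_aux hp2 ψ.degree W₁ W₀ inferInstance inferInstance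
    inferInstance inferInstance hred hW₁ hW₀ ψ rfl

end EtaleEnd

/-! ## §3. Consequences on the rank-`0` X1 leaf -/

section Leaf

variable {W : WeierstrassCurve ℚ} [W.IsElliptic] [W.IsGloballyMinimal] {p : ℕ} [hp : Fact p.Prime]

/-- **Two off-locus members of a rank-`0` X1 class have the same algebraic `μ`** (for every
cyclotomic dual datum over the same `(κ, γ)`): both are étale ends (all rational lines unramified,
type A + off the locus), §2 gives an isogeny of degree prime to `p` between them, §1 the equality.
[cite: GreenbergLNM1716, §1 p. 58 and Conj. 1.11] -/
theorem mu_eq_of_offLocus_of_offLocus (hX1 : ClassX1 W p) (hr0 : W.analyticRank = 0)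
    (hoff : ¬ HasRamifiedOddLineAt W p) {W' : WeierstrassCurve ℚ} [W'.IsElliptic] [W'.IsGloballyMinimal]
    (hiso : IsIsogenous W W') (hoff' : ¬ HasRamifiedOddLineAt W' p)
    {κ : ZpExtension ℚ p} {γ : absoluteGaloisGroup ℚ}
    (D : W.SelmerDualData κ γ) (D' : W'.SelmerDualData κ γ) : D'.mu = D.mu := by
  have hL : X1.RankZero.Leaf W p := ⟨hX1, hr0⟩
  have hL' : X1.RankZero.Leaf W' p := leaf_of_isIsogenous hX1 hr0 hiso.symm_of_charZero
  have hXc := isClassX1_of_classX1 hX1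
  obtain ⟨lam, hlam⟩ := exists_isogeny_not_dvd_degree_of_forall_lineUnramifiedAt hXc.two_ne
    (Or.inl ⟨hXc.hasGoodReductionAtPrime, hXc.not_dvd_frobeniusTrace⟩)
    (forall_lineUnramifiedAt_of_not_gvPar_of_not_hasRamifiedOddLineAt hL.not_gvPar hoff)
    (forall_lineUnramifiedAt_of_not_gvPar_of_not_hasRamifiedOddLineAt hL'.not_gvPar hoff') hiso
  exact mu_eq_of_isogeny_not_dvd_degree lam hlam D D'

/-- **`μ = 0` at one member ⇒ `μ = 0` at every OFF-LOCUS member of its rank-`0` X1 class**, granted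
Greenberg Prop. 5.7 (`h57`), Wuthrich Thm. 16 (`hW16`), modularity (`hmod`): the `μ = 0` member is
itself off the locus (`not_hasRamifiedOddLineAt_of_leaf_of_mu_eq_zero`, p468995), then
`mu_eq_of_offLocus_of_offLocus`. This is «(G_iso) ⇒ (G_loc)» WITHOUT the μ-part of the main
conjecture and without Schneider's formula. [cite: GreenbergLNM1716, Conj. 1.11 (p. 58) and Prop. 5.7 (p. 113)]
[cite: Wuthrich2014, Thm. 16 (p. 397)] [cite: BCDTJAMS2001, Theorem A] -/
theorem mu_eq_zero_offLocus_of_exists_member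
    (h57 : prop57_one_le_mu_of_ramified_odd_line) (hW16 : Wuthrich2014.charIdeal_dvd_padicLFunction)
    (hmod : nonempty_modularParametrizationData) (hX1 : ClassX1 W p) (hr0 : W.analyticRank = 0)
    (hoff : ¬ HasRamifiedOddLineAt W p) {W' : WeierstrassCurve ℚ} [W'.IsElliptic] [W'.IsGloballyMinimal]
    (hiso : IsIsogenous W W')
    (hG' : ∀ (κ : ZpExtension ℚ p) (γ : absoluteGaloisGroup ℚ),
      κ.IsCyclotomic → κ.IsTopGenerator γ → IsCyclotomicVariable p γ →
      ∀ D' : W'.SelmerDualData κ γ, D'.mu = 0)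
    {κ : ZpExtension ℚ p} {γ : absoluteGaloisGroup ℚ} (hκ : κ.IsCyclotomic)
    (hγ : κ.IsTopGenerator γ) (hγ' : IsCyclotomicVariable p γ) (D : W.SelmerDualData κ γ) :
    D.mu = 0 := by
  have hL' : X1.RankZero.Leaf W' p := leaf_of_isIsogenous hX1 hr0 hiso.symm_of_charZero
  have hoff' : ¬ HasRamifiedOddLineAt W' p :=
    not_hasRamifiedOddLineAt_of_leaf_of_mu_eq_zero h57 hW16 hmod hL' hG'
  obtain ⟨D'⟩ := W'.nonempty_selmerDualData_holds κ γ hγ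
  rw [← mu_eq_of_offLocus_of_offLocus hX1 hr0 hoff hiso hoff' D D']
  exact hG' κ γ hκ hγ hγ' D'

/-- **In a rank-`0` X1 class holding ONE member with `μ(X) = 0`, the members with `μ(X) = 0` are
EXACTLY the off-locus members** — the algebraic twin of p467959's analytic statement, granted
Prop. 5.7, Thm. 16, modularity: for `W′ ∼ W` with `μ(X(W′/ℚ_∞)) = 0` for every cyclotomic dual
datum, `(∀ cyclotomic data, μ(X(W/ℚ_∞)) = 0) ↔ ¬ HasRamifiedOddLineAt W p`. «→» Prop. 5.7 (p468995
§1); «←» `mu_eq_zero_offLocus_of_exists_member`. Greenberg, LNM 1716 p. 58: «the above conjecture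
effectively predicts the value of `μ_E`» — here, for the value `0`, as a theorem.
[cite: GreenbergLNM1716, Conj. 1.11 (p. 58) and Prop. 5.7 (p. 113)] [cite: Wuthrich2014, Thm. 16 (p. 397)] -/
theorem mu_eq_zero_iff_not_hasRamifiedOddLineAt_of_exists_member
    (h57 : prop57_one_le_mu_of_ramified_odd_line) (hW16 : Wuthrich2014.charIdeal_dvd_padicLFunction)
    (hmod : nonempty_modularParametrizationData) (hX1 : ClassX1 W p) (hr0 : W.analyticRank = 0)
    {W' : WeierstrassCurve ℚ} [W'.IsElliptic] [W'.IsGloballyMinimal] (hiso : IsIsogenous W W')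
    (hG' : ∀ (κ : ZpExtension ℚ p) (γ : absoluteGaloisGroup ℚ),
      κ.IsCyclotomic → κ.IsTopGenerator γ → IsCyclotomicVariable p γ →
      ∀ D' : W'.SelmerDualData κ γ, D'.mu = 0) :
    (∀ (κ : ZpExtension ℚ p) (γ : absoluteGaloisGroup ℚ),
        κ.IsCyclotomic → κ.IsTopGenerator γ → IsCyclotomicVariable p γ →
        ∀ D : W.SelmerDualData κ γ, D.mu = 0) ↔ ¬ HasRamifiedOddLineAt W p :=
  ⟨not_hasRamifiedOddLineAt_of_leaf_of_mu_eq_zero h57 hW16 hmod ⟨hX1, hr0⟩,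
    fun hoff _ _ hκ hγ hγ' D ↦
      mu_eq_zero_offLocus_of_exists_member h57 hW16 hmod hX1 hr0 hoff hiso hG' hκ hγ hγ' D⟩

/-- **Greenberg's conjecture on the leaf: located form ⟺ isogeny form**, granted Prop. 5.7, Thm. 16,
modularity (and NOT the μ-part of the main conjecture, cf. p468995 §4): «`μ = 0` at every off-locus
rank-`0` X1 member» ⟺ «every rank-`0` X1 class has a (globally minimal) member with `μ = 0`».
[cite: GreenbergLNM1716, Conj. 1.11 (p. 58) and Prop. 5.7 (p. 113)] [cite: Wuthrich2014, Thm. 16 (p. 397)] -/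
theorem greenbergMu_located_iff_isogenyForm
    (h57 : prop57_one_le_mu_of_ramified_odd_line) (hW16 : Wuthrich2014.charIdeal_dvd_padicLFunction)
    (hmod : nonempty_modularParametrizationData) :
    (∀ (W₀ : WeierstrassCurve ℚ) [W₀.IsElliptic] [W₀.IsGloballyMinimal] (p : ℕ) [Fact p.Prime],
      ClassX1 W₀ p → W₀.analyticRank = 0 → ¬ HasRamifiedOddLineAt W₀ p →
      ∀ (κ : ZpExtension ℚ p) (γ : absoluteGaloisGroup ℚ),
        κ.IsCyclotomic → κ.IsTopGenerator γ → IsCyclotomicVariable p γ →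
        ∀ D : W₀.SelmerDualData κ γ, D.mu = 0) ↔
    ∀ (W : WeierstrassCurve ℚ) [W.IsElliptic] [W.IsGloballyMinimal] (p : ℕ) [Fact p.Prime],
      ClassX1 W p → W.analyticRank = 0 →
      ∃ (W' : WeierstrassCurve ℚ) (_ : W'.IsElliptic) (_ : W'.IsGloballyMinimal), IsIsogenous W W' ∧
        ∀ (κ : ZpExtension ℚ p) (γ : absoluteGaloisGroup ℚ),
          κ.IsCyclotomic → κ.IsTopGenerator γ → IsCyclotomicVariable p γ →
          ∀ D : W'.SelmerDualData κ γ, D.mu = 0 := by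
  refine ⟨fun hloc W _ _ p _ hX1 hr0 ↦ greenbergMu_isogenyForm_of_located hloc W p hX1 hr0,
    fun hiso W₀ _ _ p _ hX1 hr0 hoff _ _ hκ hγ hγ' D ↦ ?_⟩
  obtain ⟨W', hE', hmin', hiso', hG'⟩ := hiso W₀ p hX1 hr0
  exact mu_eq_zero_offLocus_of_exists_member h57 hW16 hmod hX1 hr0 hoff hiso' hG' hκ hγ hγ' D

/-- **DECOMPOSITION, final form.** Granted Prop. 5.7, Thm. 16, modularity, the registered stub is
equivalent to [(M) the μ-part of Mazur's main conjecture at every off-locus rank-`0` X1 member] ∧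
[(G) Greenberg's Conj. 1.11 on the rank-`0` X1 classes] with (G) in EITHER form — located
(p462224) or as printed (isogeny form, p468995) — the two forms being equivalent by
`greenbergMu_located_iff_isogenyForm`. Recorded as the pair of `Iff`s. [cite: GreenbergLNM1716, Conj. 1.11 (p. 58)]
[cite: Wuthrich2014, Thm. 16 (p. 397)] [cite: GreenbergVatsal2000, p. 2 (1)–(2)] -/
theorem stub_iff_muPart_offLocus_and_greenbergMu
    (h57 : prop57_one_le_mu_of_ramified_odd_line) (hW16 : Wuthrich2014.charIdeal_dvd_padicLFunction)
    (hmod : nonempty_modularParametrizationData) :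
    ((∀ (W₀ : WeierstrassCurve ℚ) [W₀.IsElliptic] [W₀.IsGloballyMinimal] (p : ℕ) [Fact p.Prime],
        ClassX1 W₀ p → W₀.analyticRank = 0 → ¬ HasRamifiedOddLineAt W₀ p →
          X1.MuPart.AnalyticMuLE W₀ p 0) ↔
      (∀ (W₀ : WeierstrassCurve ℚ) [W₀.IsElliptic] [W₀.IsGloballyMinimal] (p : ℕ) [Fact p.Prime],
          ClassX1 W₀ p → W₀.analyticRank = 0 → ¬ HasRamifiedOddLineAt W₀ p → X1.MuLambda.MuPartAt W₀ p) ∧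
        ∀ (W₀ : WeierstrassCurve ℚ) [W₀.IsElliptic] [W₀.IsGloballyMinimal] (p : ℕ) [Fact p.Prime],
          ClassX1 W₀ p → W₀.analyticRank = 0 → ¬ HasRamifiedOddLineAt W₀ p →
          ∀ (κ : ZpExtension ℚ p) (γ : absoluteGaloisGroup ℚ),
            κ.IsCyclotomic → κ.IsTopGenerator γ → IsCyclotomicVariable p γ →
            ∀ D : W₀.SelmerDualData κ γ, D.mu = 0) ∧
    ((∀ (W₀ : WeierstrassCurve ℚ) [W₀.IsElliptic] [W₀.IsGloballyMinimal] (p : ℕ) [Fact p.Prime],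
        ClassX1 W₀ p → W₀.analyticRank = 0 → ¬ HasRamifiedOddLineAt W₀ p →
          X1.MuPart.AnalyticMuLE W₀ p 0) ↔
      (∀ (W₀ : WeierstrassCurve ℚ) [W₀.IsElliptic] [W₀.IsGloballyMinimal] (p : ℕ) [Fact p.Prime],
          ClassX1 W₀ p → W₀.analyticRank = 0 → ¬ HasRamifiedOddLineAt W₀ p → X1.MuLambda.MuPartAt W₀ p) ∧
        ∀ (W : WeierstrassCurve ℚ) [W.IsElliptic] [W.IsGloballyMinimal] (p : ℕ) [Fact p.Prime],
          ClassX1 W p → W.analyticRank = 0 →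
          ∃ (W' : WeierstrassCurve ℚ) (_ : W'.IsElliptic) (_ : W'.IsGloballyMinimal), IsIsogenous W W' ∧
            ∀ (κ : ZpExtension ℚ p) (γ : absoluteGaloisGroup ℚ),
              κ.IsCyclotomic → κ.IsTopGenerator γ → IsCyclotomicVariable p γ →
              ∀ D : W'.SelmerDualData κ γ, D.mu = 0) :=
  ⟨stub_iff_muPart_and_greenbergMu_offLocus hW16 hmod,
    stub_iff_muPart_offLocus_and_greenbergMu_isogenyForm h57 hW16 hmod⟩

end Leaf

end Summit.BirchSwinnertonDyer.BirchSwinnertonDyer.Theorems.EisensteinPrimesMazurMCOnX1RankZeroMuEtaleEnd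

end
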